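import Literature.LinearAlgebra.TensorNetworks.TensorCrossExactRecovery

/-!
# Tensor cross interpolation: every tensor has an exact fully nested TCI (CI-canonical form)

Let `F` be a tensor with `L = n+1` legs indexed by a FINITE type `σ` (a function
`F : List σ → K` on configurations, `K` a field), with unfolding matrices
`A^{(ℓ)}(x, y) = F(x ⊕ y)` (rows: multi-indices `x` of the legs `< ℓ`, columns: multi-indices `y`
of the legs `≥ ℓ`; `TCIPivots.unfolding` of `TensorCrossExactRecovery`).  The companion files prove,
for GIVEN pivot lists `I_ℓ`, `J_{ℓ+1}` with nonsingular pivot matrices `P_ℓ = A^{(ℓ)}(I_ℓ, J_{ℓ+1})`,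
that the TCI form `F̃ = T₀ P₁⁻¹ T₁ ⋯ P_n⁻¹ T_n` interpolates `F` on its slices when the pivots are
nested [NunezFernandezEtAl2025, §4.2; DolgovSavostyanov2020, §3.2 Thm. 1] and recovers `F`
everywhere when `χ_ℓ = |I_ℓ| = |J_{ℓ+1}| = rank A^{(ℓ)}` [DolgovSavostyanov2020, §3.2 Thm. 2].
This file supplies the EXISTENCE half — the output specification of the CI-canonicalization
algorithm of [NunezFernandezEtAl2025, §4.5.1]:

> **Theorem** (CI-canonical form) [NunezFernandezEtAl2025, §4.5.1; DolgovSavostyanov2020, §3.2].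
> Every tensor `F` with `n+1` legs and finitely many leg values admits pivot lists
> `I_0, …, I_{n+1}`, `J_1, …, J_{n+2}` that are FULLY NESTED (`I_0 < I_1 < ⋯ < I_n`,
> `J_2 > ⋯ > J_{n+2}`), have `χ_ℓ = |I_ℓ| = |J_{ℓ+1}| = rank A^{(ℓ)}` elements and a NONSINGULAR
> pivot matrix `P_ℓ` at every inner bond `1 ≤ ℓ ≤ n`.  Consequently the fully nested TCI form on
> these pivots reproduces `F` EXACTLY, "all ingredients are slices of `F`, labeled by
> multi-indices, and each `T_ℓ` is full rank for both ways of viewing it as a matrix,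
> `[T]_{(i_{ℓ-1}, σ_ℓ) j_{ℓ+1}}` or `[T]_{i_{ℓ-1} (σ_ℓ, j_{ℓ+1})}`"; the bond dimensions
> `χ_ℓ = rank A^{(ℓ)}` are "an intrinsic property of `F`".

(With nested pivots the exactness statement is the original TT-cross theorem of
Oseledets–Tyrtyshnikov (2010), "first proven … with the additional requirement of nestedness"
[DolgovSavostyanov2020, §3.2].)

The proof formalised here is a direct rank argument on the unfoldings, in the shape of the
sweeps of [NunezFernandezEtAl2025, §4.5.1] but non-algorithmic (bases are chosen by `choice`):
* FORWARD SWEEP OF ROW BASES.  `I_0 = {()}`.  If the rows `I_ℓ` span the row space of `A^{(ℓ)}`,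
  then the extended rows `I_ℓ × 𝕊_ℓ = {x ⊕ (c)}` span the row space of `A^{(ℓ+1)}` — row
  `x' ⊕ (c)` of `A^{(ℓ+1)}` at column `y` is row `x'` of `A^{(ℓ)}` at column `(c) ⊕ y`
  (`unfolding₂_mem_span_snoc`) — so a row basis `I_{ℓ+1} ⊆ I_ℓ × 𝕊_ℓ` of `A^{(ℓ+1)}` with
  `rank A^{(ℓ+1)}` elements can be selected, and a basis spans again.  This gives left-nested,
  linearly independent row pivots `I_0 < I_1 < ⋯ < I_n` with `|I_ℓ| = rank A^{(ℓ)}`.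
* BACKWARD SWEEP OF COLUMN BASES.  Symmetrically `J_{n+2} = {()}` and column bases
  `J_{ℓ+1} ⊆ 𝕊_ℓ × J_{ℓ+2}` of `A^{(ℓ)}` (`unfolding₂_transpose_mem_span_cons`), right-nested,
  with `|J_{ℓ+1}| = rank (A^{(ℓ)})ᵀ = rank A^{(ℓ)}`.
* NONSINGULAR CROSSES.  For a matrix `A` of rank `k`, `k` linearly independent rows `r` and `k`
  linearly independent columns `c`, the cross `A[r, c]` is invertible (every row of `A` is a
  combination of the rows `r`, so `A[:, c] = M ⬝ A[r, c]` has rank `k`) — hence every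
  `P_ℓ = A^{(ℓ)}(I_ℓ, J_{ℓ+1})` is nonsingular, with no third sweep needed.
Exactness then follows from `TCIPivots.tciEval_of_rank_eq`, and the full rank of the slices from
nesting (`P_{ℓ+1}`, resp. `P_ℓ`, is a row-, resp. column-submatrix of the regrouped `T_ℓ`).

Contents (legs `0, …, n`, bonds `0, …, n+1`, as in `TensorCrossInterpolation`):

* `unfolding₂ F a b` — the unfolding with row multi-indices of length `a` and column
  multi-indices of length `b` (`= TCIPivots.unfolding` for `a + b = n + 1`, definitionally:
  `TCIPivots.unfolding_eq_unfolding₂`); `unfolding₂_succ_left` (the one-leg shift),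
  `unfolding₂_mem_span_snoc`, `unfolding₂_transpose_mem_span_cons` (span propagation)
  [NunezFernandezEtAl2025, §4.5.1; DolgovSavostyanov2020, §3.1];
* `ciRank F n`, `ciPivots F n d : TCIPivots σ` — THE CI-CANONICAL PIVOTS of `F` (the element
  `d : σ` only fills the never-read junk fields `col 0`, `row (n+1)`), with `ciPivots_n`,
  `χ_ciPivots_eq_rank` (`χ_ℓ = rank A^{(ℓ)}` for `1 ≤ ℓ ≤ n`), `fullyNested_ciPivots`,
  `isUnit_det_pivMat_ciPivots`, and the exactness `tciEval_ciPivots`, `tciEval_ciPivots_toSeq`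
  (`F̃ = F` at every configuration); prose form `exists_fullyNested_exact_tci`
  [NunezFernandezEtAl2025, §4.5.1; DolgovSavostyanov2020, §3.2 Thms. 1–2];
* minimality / uniqueness of the bond dimensions: `TCIPivots.χ_le_rank_unfolding` (any pivot
  structure with a nonsingular `P_ℓ` has `χ_ℓ ≤ rank A^{(ℓ)}`), `TCIPivots.χ_eq_χ_ciPivots_of_exact`
  (an exact TCI with nonsingular pivot matrices has exactly the CI-canonical bond dimensions)
  [DolgovSavostyanov2020, §3.2 Thm. 2; NunezFernandezEtAl2025, §4.5.1];
* the two regroupings of a slice, `TCIPivots.siteMatRows` (`(I_ℓ × 𝕊_ℓ) × J_{ℓ+2}`) and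
  `TCIPivots.siteMatCols` (`I_ℓ × (𝕊_ℓ × J_{ℓ+2})`), `submatrix_siteMatRows_eq_pivMat`,
  `submatrix_siteMatCols_eq_pivMat`, and FULL RANK OF THE SLICES:
  `TCIPivots.rank_siteMatRows_of_rowNested`, `TCIPivots.rank_siteMatCols_of_colNested` (for any
  nested pivots with nonsingular pivot matrices), `rank_siteMatRows_ciPivots`,
  `rank_siteMatCols_ciPivots` [NunezFernandezEtAl2025, §4.4.1 and §4.5.1];
* tensor trains (MPS → TCI conversion): `rank_unfolding₂_le_of_tensorTrain` (`rank A^{(ℓ)} ≤ r_ℓ`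
  for the tensor represented by a `TensorTrain` of `QuanticsTensorTrain` with bond dimensions
  `r_ℓ`), `χ_ciPivots_le_of_tensorTrain` (`χ_ℓ ≤ r_ℓ`), `tciEval_ciPivots_ofFn_of_tensorTrain`
  (the fully nested TCI reproduces the tensor train) [NunezFernandezEtAl2025, §4.5;
  NunezFernandezEtAl2022, §III.B.1].

Not formalised: the CI-canonicalization ALGORITHM itself (three half-sweeps of exact prrLU / CI
factorisations of the MPS cores in `O(χ³)` operations), its variant with compression and the
LU-canonicalization [NunezFernandezEtAl2025, §4.5.1–§4.5.2], error bounds for approximately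
low-rank tensors (maximum volume), and uniqueness questions for the pivot lists themselves (only
the bond dimensions are canonical; the pivots are a choice of bases).

References: Y. Núñez Fernández, M. K. Ritter, M. Jeannin, J.-W. Li, T. Kloss, T. Louvet,
S. Terasaki, O. Parcollet, J. von Delft, H. Shinaoka, X. Waintal, *Learning tensor networks with
tensor cross interpolation: new algorithms and libraries*, SciPost Phys. 18 (2025) 104,
arXiv:2407.02454 (`NunezFernandezEtAl2025`), §4.2, §4.4.1, §4.5, §4.5.1; S. Dolgov,
D. Savostyanov, *Parallel cross interpolation for high-precision calculation of high-dimensional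
integrals*, Comput. Phys. Commun. 246 (2020) 106869, arXiv:1903.11554 (`DolgovSavostyanov2020`),
§3.1, §3.2 Thms. 1–2 (numbering of the arXiv version); Y. Núñez Fernández, M. Jeannin,
P. T. Dumitrescu, T. Kloss, J. Kaye, O. Parcollet, X. Waintal, *Learning Feynman diagrams with
tensor trains*, Phys. Rev. X 12 (2022) 041018, arXiv:2207.06135 (`NunezFernandezEtAl2022`),
§III.B.1, eq. (17); I. Oseledets, E. Tyrtyshnikov, *TT-cross approximation for multidimensional
arrays*, Linear Algebra Appl. 432 (2010) 70–88 (`OseledetsTyrtyshnikov2010`; the nested exact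
TT-cross theorem, as attributed in [DolgovSavostyanov2020, §3.2]).

AI-produced formalisation (H21 engines group, seat eng-quad-2, 2026-08-22); no facts, no axioms
beyond Mathlib's, no `sorry`.
-/

open Matrix

namespace Literature.LinearAlgebra.TensorNetworks

/-! ### Linear algebra: row bases, spanning, and the nonsingular cross -/

section LinearAlgebra

variable {K : Type*} [Field K] {m n : Type*} [Fintype m] [Fintype n]

/-- Linearly independent rows, as many as the rank, span the row space.  [folklore] -/
private theorem mem_span_rows_of_linearIndependent {k : ℕ} (A : Matrix m n K) (r : Fin k → m)
    (hli : LinearIndependent K (fun t => A (r t))) (hk : k = A.rank) (x : m) :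
    A x ∈ Submodule.span K (Set.range fun t => A (r t)) := by
  have h1 : Module.finrank K (Submodule.span K (Set.range fun t => A (r t))) = k := by
    rw [finrank_span_eq_card hli, Fintype.card_fin]
  have hle : Submodule.span K (Set.range fun t => A (r t)) ≤
      Submodule.span K (Set.range A.row) :=
    Submodule.span_mono (by rintro _ ⟨t, rfl⟩; exact ⟨r t, rfl⟩)
  have heq : Submodule.span K (Set.range fun t => A (r t)) =
      Submodule.span K (Set.range A.row) :=
    Submodule.eq_of_le_of_finrank_eq hle (by rw [h1, hk, Matrix.rank_eq_finrank_span_row])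
  rw [heq]
  exact Submodule.subset_span ⟨x, rfl⟩

/-- Basis selection inside a spanning family of rows: if the rows `A (v i)`, `i : ι` (finitely
many candidates), span the row space of `A`, then `rank A` of them are linearly independent.
[folklore] -/
private theorem exists_linearIndependent_rows_of_span {ι : Type*} [Fintype ι] (A : Matrix m n K)
    (v : ι → m) (hv : ∀ x, A x ∈ Submodule.span K (Set.range fun i => A (v i))) :
    ∃ r : Fin A.rank → m, (∀ t, ∃ i, r t = v i) ∧ LinearIndependent K (fun t => A (r t)) := by
  classical
  obtain ⟨κ, a, ha, hspan, hli⟩ := exists_linearIndependent' (K := K) (fun i => A (v i))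
  haveI : Fintype κ := Fintype.ofInjective a ha
  have hsp : Submodule.span K (Set.range fun i => A (v i)) =
      Submodule.span K (Set.range A.row) := by
    apply le_antisymm
    · exact Submodule.span_mono (by rintro _ ⟨i, rfl⟩; exact ⟨v i, rfl⟩)
    · rw [Submodule.span_le]
      rintro _ ⟨x, rfl⟩
      exact hv x
  have hcard : Fintype.card κ = A.rank := by
    have h1 : Module.finrank K (Submodule.span K (Set.range ((fun i => A (v i)) ∘ a))) =
        Fintype.card κ := finrank_span_eq_card hli
    rw [hspan, hsp, ← Matrix.rank_eq_finrank_span_row] at h1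
    exact h1.symm
  let e : Fin A.rank ≃ κ := (Fintype.equivFinOfCardEq hcard).symm
  exact ⟨fun t => v (a (e t)), fun t => ⟨a (e t), rfl⟩, hli.comp e e.injective⟩

/-- THE CROSS OF A ROW BASIS AND A COLUMN BASIS IS NONSINGULAR: if `rank A` rows `r` of `A` are
linearly independent and `rank A` columns `c` of `A` are linearly independent, then the square
submatrix `A[r, c]` is invertible.  (Every row of `A` is a combination of the rows `r`, so
`A[:, c] = M ⬝ A[r, c]` has rank `rank A`, forcing `rank A[r, c] = rank A`.)  [folklore] -/
private theorem isUnit_det_submatrix_of_linearIndependent {k : ℕ} (A : Matrix m n K)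
    (r : Fin k → m) (c : Fin k → n) (hr : LinearIndependent K (fun t => A (r t)))
    (hc : LinearIndependent K (fun t => Aᵀ (c t))) (hk : k = A.rank) :
    IsUnit (A.submatrix r c).det := by
  classical
  have hrow : ∀ x, ∃ w : Fin k → K, ∑ t, w t • A (r t) = A x := fun x =>
    (Submodule.mem_span_range_iff_exists_fun K).1
      (mem_span_rows_of_linearIndependent A r hr hk x)
  choose w hw using hrow
  have hA : A.submatrix id c = Matrix.of w * A.submatrix r c := by
    ext x t
    have h := congr_fun (hw x) (c t)
    simp only [Finset.sum_apply, Pi.smul_apply, smul_eq_mul] at h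
    simp only [Matrix.submatrix_apply, id, Matrix.mul_apply, Matrix.of_apply]
    exact h.symm
  have hrk : (A.submatrix id c).rank = k := by
    have hli : LinearIndependent K (A.submatrix id c)ᵀ.row := hc
    have h := hli.rank_matrix
    rwa [Matrix.rank_transpose, Fintype.card_fin] at h
  have hS : (A.submatrix r c).rank = Fintype.card (Fin k) := by
    refine le_antisymm (Matrix.rank_le_card_width _) ?_
    rw [Fintype.card_fin]
    calc k = (A.submatrix id c).rank := hrk.symm
      _ = (Matrix.of w * A.submatrix r c).rank := by rw [hA]
      _ ≤ (A.submatrix r c).rank := Matrix.rank_mul_le_right _ _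
  have hli : LinearIndependent K (A.submatrix r c).row := by
    rw [linearIndependent_iff_card_eq_finrank_span, Set.finrank,
      ← Matrix.rank_eq_finrank_span_row, hS]
  exact (Matrix.isUnit_iff_isUnit_det _).1 (Matrix.linearIndependent_rows_iff_isUnit.1 hli)

end LinearAlgebra

/-! ### The two-length unfolding matrices of a tensor -/

section Unfolding

variable {σ : Type*} {K : Type*}

/-- The UNFOLDING MATRIX of the tensor `F` with row multi-indices of length `a` and column
multi-indices of length `b`: `(x, y) ↦ F (x ⊕ y)`.  For an `(n+1)`-leg tensor and `a + b = n + 1`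
this is the bond-`a` unfolding `A^{(a)}` (`TCIPivots.unfolding`, definitionally); keeping both
lengths free makes the one-leg shift `F((x ⊕ c) ⊕ y) = F(x ⊕ (c ⊕ y))` between the unfoldings at
consecutive bonds a definitional matter.  [cite: DolgovSavostyanov2020, §3.1] -/
def unfolding₂ (F : List σ → K) (a b : ℕ) : Matrix (List.Vector σ a) (List.Vector σ b) K :=
  Matrix.of fun x y => F (x.1 ++ y.1)

/-- [cite: DolgovSavostyanov2020, §3.1] -/
@[simp] theorem unfolding₂_apply (F : List σ → K) (a b : ℕ) (x : List.Vector σ a)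
    (y : List.Vector σ b) : unfolding₂ F a b x y = F (x.1 ++ y.1) := rfl

/-- The bond-`ℓ` unfolding of `TCIPivots` is `unfolding₂ F ℓ (n + 1 - ℓ)`.
[cite: DolgovSavostyanov2020, §3.1] -/
theorem TCIPivots.unfolding_eq_unfolding₂ (p : TCIPivots σ) (F : List σ → K) (ℓ : ℕ) :
    p.unfolding F ℓ = unfolding₂ F ℓ (p.n + 1 - ℓ) := rfl

/-- Appending one leg index to a row multi-index.  [folklore] -/
private def snocVec {a : ℕ} (x : List.Vector σ a) (c : σ) : List.Vector σ (a + 1) :=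
  ⟨x.1 ++ [c], by simp⟩

/-- Prepending one leg index to a column multi-index.  [folklore] -/
private def consVec {b : ℕ} (c : σ) (y : List.Vector σ b) : List.Vector σ (b + 1) :=
  ⟨c :: y.1, by simp⟩

/-- [folklore] -/
@[simp] private theorem snocVec_val {a : ℕ} (x : List.Vector σ a) (c : σ) :
    (snocVec x c).1 = x.1 ++ [c] := rfl

/-- [folklore] -/
@[simp] private theorem consVec_val {b : ℕ} (c : σ) (y : List.Vector σ b) :
    (consVec c y).1 = c :: y.1 := rfl

/-- The one-leg shift between consecutive unfoldings: row `x ⊕ (c)` of the `(a+1, b)` unfolding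
at column `y` is row `x` of the `(a, b+1)` unfolding at column `(c) ⊕ y`.
[cite: NunezFernandezEtAl2025, §4.2] -/
theorem unfolding₂_succ_left (F : List σ → K) (a b : ℕ) (x : List.Vector σ a) (c : σ)
    (y : List.Vector σ b) :
    unfolding₂ F (a + 1) b ⟨x.1 ++ [c], by simp⟩ y = unfolding₂ F a (b + 1) x ⟨c :: y.1, by simp⟩ := by
  simp [unfolding₂, List.append_assoc]

/-- Every multi-index of length `a + 1` is `x ⊕ (c)`.  [folklore] -/
private theorem exists_eq_snocVec {a : ℕ} (x' : List.Vector σ (a + 1)) :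
    ∃ (x : List.Vector σ a) (c : σ), x' = snocVec x c := by
  obtain ⟨l, hl⟩ := x'
  rcases List.eq_nil_or_concat' l with h | ⟨L, c, h⟩
  · subst h; simp at hl
  · subst h
    refine ⟨⟨L, by simpa using hl⟩, c, rfl⟩

/-- Every multi-index of length `b + 1` is `(c) ⊕ y`.  [folklore] -/
private theorem exists_eq_consVec {b : ℕ} (y' : List.Vector σ (b + 1)) :
    ∃ (c : σ) (y : List.Vector σ b), y' = consVec c y := by
  obtain ⟨l, hl⟩ := y'
  obtain ⟨c, L, h⟩ := List.exists_of_length_succ l hl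
  subst h
  exact ⟨c, ⟨L, by simpa using hl⟩, rfl⟩

variable [Field K]

/-- ROW SPAN PROPAGATES ONE LEG TO THE RIGHT: if the rows `I` span the row space of the
`(a, b+1)` unfolding, then the extended rows `I × 𝕊 = {x ⊕ (c)}` span the row space of the
`(a+1, b)` unfolding.  [cite: NunezFernandezEtAl2025, §4.5.1][cite: DolgovSavostyanov2020, §3.1] -/
theorem unfolding₂_mem_span_snoc (F : List σ → K) (a b : ℕ) {k : ℕ} (I : Fin k → List.Vector σ a)
    (hI : ∀ x, unfolding₂ F a (b + 1) x ∈
      Submodule.span K (Set.range fun t => unfolding₂ F a (b + 1) (I t)))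
    (x' : List.Vector σ (a + 1)) :
    unfolding₂ F (a + 1) b x' ∈ Submodule.span K
      (Set.range fun q : Fin k × σ =>
        unfolding₂ F (a + 1) b ⟨(I q.1).1 ++ [q.2], by simp⟩) := by
  classical
  obtain ⟨x, c, rfl⟩ := exists_eq_snocVec x'
  obtain ⟨w, hw⟩ := (Submodule.mem_span_range_iff_exists_fun K).1 (hI x)
  have key : unfolding₂ F (a + 1) b (snocVec x c) =
      ∑ t, w t • unfolding₂ F (a + 1) b ⟨(I t).1 ++ [c], by simp⟩ := by
    funext y
    have h := congr_fun hw (consVec c y)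
    simp only [Finset.sum_apply, Pi.smul_apply, smul_eq_mul, unfolding₂_apply, consVec_val,
      snocVec_val, List.append_assoc, List.singleton_append] at h ⊢
    exact h.symm
  rw [key]
  exact Submodule.sum_mem _ fun t _ =>
    Submodule.smul_mem _ _ (Submodule.subset_span ⟨(t, c), rfl⟩)

/-- COLUMN SPAN PROPAGATES ONE LEG TO THE LEFT: if the columns `J` span the column space of the
`(a+1, b)` unfolding, then the extended columns `𝕊 × J = {(c) ⊕ y}` span the column space of the
`(a, b+1)` unfolding.  [cite: NunezFernandezEtAl2025, §4.5.1][cite: DolgovSavostyanov2020, §3.1] -/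
theorem unfolding₂_transpose_mem_span_cons (F : List σ → K) (a b : ℕ) {k : ℕ}
    (J : Fin k → List.Vector σ b)
    (hJ : ∀ y, (unfolding₂ F (a + 1) b)ᵀ y ∈
      Submodule.span K (Set.range fun t => (unfolding₂ F (a + 1) b)ᵀ (J t)))
    (y' : List.Vector σ (b + 1)) :
    (unfolding₂ F a (b + 1))ᵀ y' ∈ Submodule.span K
      (Set.range fun q : σ × Fin k =>
        (unfolding₂ F a (b + 1))ᵀ ⟨q.1 :: (J q.2).1, by simp⟩) := by
  classical
  obtain ⟨c, y, rfl⟩ := exists_eq_consVec y'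
  obtain ⟨w, hw⟩ := (Submodule.mem_span_range_iff_exists_fun K).1 (hJ y)
  have key : (unfolding₂ F a (b + 1))ᵀ (consVec c y) =
      ∑ t, w t • (unfolding₂ F a (b + 1))ᵀ ⟨c :: (J t).1, by simp⟩ := by
    funext x
    have h := congr_fun hw (snocVec x c)
    simp only [Finset.sum_apply, Pi.smul_apply, smul_eq_mul, Matrix.transpose_apply,
      unfolding₂_apply, consVec_val, snocVec_val, List.append_assoc, List.singleton_append] at h ⊢
    exact h.symm
  rw [key]
  exact Submodule.sum_mem _ fun t _ =>
    Submodule.smul_mem _ _ (Submodule.subset_span ⟨(c, t), rfl⟩)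

end Unfolding

/-! ### The left-to-right row recursion and the right-to-left column recursion -/

section Chains

variable {σ : Type*} [Fintype σ] {K : Type*} [Field K] (F : List σ → K) (n : ℕ)

/-- State of the row recursion at bond `ℓ` (row multi-indices of length `ℓ`): `k` selected rows
`sel` whose rows of the bond-`ℓ` unfolding span its row space (for the column length `b` with
`ℓ + b = n + 1`; vacuous at the junk bonds `ℓ > n + 1`).  [folklore] -/
private structure RowSel (ℓ : ℕ) where
  /-- number of selected rows -/
  k : ℕ
  /-- the selected row multi-indices -/
  sel : Fin k → List.Vector σ ℓ
  /-- they span the row space of the bond-`ℓ` unfolding -/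
  span : ∀ b, ℓ + b = n + 1 → ∀ x, unfolding₂ F ℓ b x ∈
    Submodule.span K (Set.range fun t => unfolding₂ F ℓ b (sel t))

/-- State of the column recursion at column length `j` (bond `n + 1 - j`): `k` selected columns
`sel` whose columns of the unfolding span its column space (for the row length `a` with
`a + j = n + 1`).  [folklore] -/
private structure ColSel (j : ℕ) where
  /-- number of selected columns -/
  k : ℕ
  /-- the selected column multi-indices -/
  sel : Fin k → List.Vector σ j
  /-- they span the column space of the unfolding with columns of length `j` -/
  span : ∀ a, a + j = n + 1 → ∀ y, (unfolding₂ F a j)ᵀ y ∈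
    Submodule.span K (Set.range fun t => (unfolding₂ F a j)ᵀ (sel t))

variable {F n}

/-- THE ROW STEP `I_ℓ ↦ I_{ℓ+1} ⊆ I_ℓ × 𝕊`: from spanning rows at bond `ℓ ≤ n`, `rank A^{(ℓ+1)}`
linearly independent rows of `A^{(ℓ+1)}` among the extensions `x ⊕ (c)`, `x ∈ I_ℓ`.
[cite: NunezFernandezEtAl2025, §4.5.1][cite: DolgovSavostyanov2020, §3.2] -/
private theorem RowSel.exists_step {ℓ : ℕ} (hℓ : ℓ ≤ n) (R : RowSel F n ℓ) :
    ∃ r : Fin (unfolding₂ F (ℓ + 1) (n - ℓ)).rank → List.Vector σ (ℓ + 1),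
      (∀ t, ∃ (s : Fin R.k) (c : σ), (r t).1 = (R.sel s).1 ++ [c]) ∧
      LinearIndependent K (fun t => unfolding₂ F (ℓ + 1) (n - ℓ) (r t)) := by
  obtain ⟨r, hr, hli⟩ := exists_linearIndependent_rows_of_span (unfolding₂ F (ℓ + 1) (n - ℓ))
    (fun q : Fin R.k × σ => (⟨(R.sel q.1).1 ++ [q.2], by simp⟩ : List.Vector σ (ℓ + 1)))
    (unfolding₂_mem_span_snoc F ℓ (n - ℓ) R.sel (R.span (n - ℓ + 1) (by omega)))
  refine ⟨r, fun t => ?_, hli⟩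
  obtain ⟨q, hq⟩ := hr t
  exact ⟨q.1, q.2, by rw [hq]⟩

/-- The row step as data (a choice of the rows of `RowSel.exists_step`).  [folklore] -/
private noncomputable def RowSel.step {ℓ : ℕ} (hℓ : ℓ ≤ n) (R : RowSel F n ℓ) :
    RowSel F n (ℓ + 1) where
  k := (unfolding₂ F (ℓ + 1) (n - ℓ)).rank
  sel := Classical.choose (R.exists_step hℓ)
  span := fun b hb x => by
    obtain rfl : b = n - ℓ := by omega
    exact mem_span_rows_of_linearIndependent _ _ (Classical.choose_spec (R.exists_step hℓ)).2
      rfl x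

/-- [folklore] -/
private theorem RowSel.step_nested {ℓ : ℕ} (hℓ : ℓ ≤ n) (R : RowSel F n ℓ) (t : Fin (R.step hℓ).k) :
    ∃ (s : Fin R.k) (c : σ), ((R.step hℓ).sel t).1 = (R.sel s).1 ++ [c] :=
  (Classical.choose_spec (R.exists_step hℓ)).1 t

/-- [folklore] -/
private theorem RowSel.step_linearIndependent {ℓ : ℕ} (hℓ : ℓ ≤ n) (R : RowSel F n ℓ) :
    LinearIndependent K (fun t => unfolding₂ F (ℓ + 1) (n - ℓ) ((R.step hℓ).sel t)) :=
  (Classical.choose_spec (R.exists_step hℓ)).2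

/-- THE COLUMN STEP `J_{ℓ+2} ↦ J_{ℓ+1} ⊆ 𝕊 × J_{ℓ+2}`: from spanning columns of length `j ≤ n`,
`rank` linearly independent columns of length `j + 1` among the extensions `(c) ⊕ y`.
[cite: NunezFernandezEtAl2025, §4.5.1][cite: DolgovSavostyanov2020, §3.2] -/
private theorem ColSel.exists_step {j : ℕ} (hj : j ≤ n) (C : ColSel F n j) :
    ∃ c : Fin ((unfolding₂ F (n - j) (j + 1))ᵀ).rank → List.Vector σ (j + 1),
      (∀ t, ∃ (s : Fin C.k) (a : σ), (c t).1 = a :: (C.sel s).1) ∧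
      LinearIndependent K (fun t => (unfolding₂ F (n - j) (j + 1))ᵀ (c t)) := by
  obtain ⟨c, hc, hli⟩ := exists_linearIndependent_rows_of_span
    ((unfolding₂ F (n - j) (j + 1))ᵀ)
    (fun q : σ × Fin C.k => (⟨q.1 :: (C.sel q.2).1, by simp⟩ : List.Vector σ (j + 1)))
    (unfolding₂_transpose_mem_span_cons F (n - j) j C.sel (C.span (n - j + 1) (by omega)))
  refine ⟨c, fun t => ?_, hli⟩
  obtain ⟨q, hq⟩ := hc t
  exact ⟨q.2, q.1, by rw [hq]⟩

/-- The column step as data.  [folklore] -/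
private noncomputable def ColSel.step {j : ℕ} (hj : j ≤ n) (C : ColSel F n j) :
    ColSel F n (j + 1) where
  k := ((unfolding₂ F (n - j) (j + 1))ᵀ).rank
  sel := Classical.choose (C.exists_step hj)
  span := fun a ha y => by
    obtain rfl : a = n - j := by omega
    exact mem_span_rows_of_linearIndependent _ _ (Classical.choose_spec (C.exists_step hj)).2
      rfl y

/-- [folklore] -/
private theorem ColSel.step_nested {j : ℕ} (hj : j ≤ n) (C : ColSel F n j) (t : Fin (C.step hj).k) :
    ∃ (s : Fin C.k) (a : σ), ((C.step hj).sel t).1 = a :: (C.sel s).1 :=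
  (Classical.choose_spec (C.exists_step hj)).1 t

/-- [folklore] -/
private theorem ColSel.step_linearIndependent {j : ℕ} (hj : j ≤ n) (C : ColSel F n j) :
    LinearIndependent K (fun t => (unfolding₂ F (n - j) (j + 1))ᵀ ((C.step hj).sel t)) :=
  (Classical.choose_spec (C.exists_step hj)).2

variable (F n)

/-- Bond `0`: the single empty row multi-index `I_0 = {()}` (its row IS the whole tensor, so it
spans).  [folklore] -/
private def RowSel.zero : RowSel F n 0 where
  k := 1
  sel := fun _ => List.Vector.nil
  span := fun b _ x => by
    rw [x.eq_nil]
    exact Submodule.subset_span ⟨0, rfl⟩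

/-- Junk state at the bonds `ℓ > n + 1` (no column length fits).  [folklore] -/
private def RowSel.junk (ℓ : ℕ) (h : n + 1 < ℓ) : RowSel F n ℓ where
  k := 0
  sel := Fin.elim0
  span := fun b hb => absurd hb (by omega)

/-- Column length `0` (bond `n + 1`): the single empty column multi-index `J_{L+1} = {()}`.
[folklore] -/
private def ColSel.zero : ColSel F n 0 where
  k := 1
  sel := fun _ => List.Vector.nil
  span := fun a _ y => by
    rw [y.eq_nil]
    exact Submodule.subset_span ⟨0, rfl⟩

/-- Junk state at column lengths `j > n + 1`.  [folklore] -/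
private def ColSel.junk (j : ℕ) (h : n + 1 < j) : ColSel F n j where
  k := 0
  sel := Fin.elim0
  span := fun a ha => absurd ha (by omega)

/-- THE ROW CHAIN `I_0 < I_1 < ⋯ < I_{n}` (left-to-right sweep of row steps).
[cite: NunezFernandezEtAl2025, §4.5.1] -/
private noncomputable def rowChain : (ℓ : ℕ) → RowSel F n ℓ
  | 0 => RowSel.zero F n
  | ℓ + 1 => if h : ℓ ≤ n then (rowChain ℓ).step h else RowSel.junk F n (ℓ + 1) (by omega)

/-- THE COLUMN CHAIN `J_{n+2} > J_{n+1} > ⋯ > J_2`, indexed by the column length `j = n + 1 - ℓ`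
(right-to-left sweep of column steps).  [cite: NunezFernandezEtAl2025, §4.5.1] -/
private noncomputable def colChain : (j : ℕ) → ColSel F n j
  | 0 => ColSel.zero F n
  | j + 1 => if h : j ≤ n then (colChain j).step h else ColSel.junk F n (j + 1) (by omega)

/-- [folklore] -/
private theorem rowChain_succ {ℓ : ℕ} (h : ℓ ≤ n) :
    rowChain F n (ℓ + 1) = (rowChain F n ℓ).step h := by
  rw [rowChain, dif_pos h]

/-- [folklore] -/
private theorem colChain_succ {j : ℕ} (h : j ≤ n) :
    colChain F n (j + 1) = (colChain F n j).step h := by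
  rw [colChain, dif_pos h]

/-- `χ_ℓ = rank A^{(ℓ)}` along the row chain, `1 ≤ ℓ ≤ n + 1`.  [folklore] -/
private theorem rowChain_k {ℓ : ℕ} (h₁ : 1 ≤ ℓ) (h : ℓ ≤ n + 1) :
    (rowChain F n ℓ).k = (unfolding₂ F ℓ (n + 1 - ℓ)).rank := by
  obtain ⟨ℓ, rfl⟩ : ∃ ℓ', ℓ = ℓ' + 1 := ⟨ℓ - 1, by omega⟩
  rw [rowChain_succ F n (by omega), show n + 1 - (ℓ + 1) = n - ℓ by omega]
  rfl

/-- [folklore] -/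
private theorem colChain_k {j : ℕ} (h₁ : 1 ≤ j) (h : j ≤ n + 1) :
    (colChain F n j).k = ((unfolding₂ F (n + 1 - j) j)ᵀ).rank := by
  obtain ⟨j, rfl⟩ : ∃ j', j = j' + 1 := ⟨j - 1, by omega⟩
  rw [colChain_succ F n (by omega), show n + 1 - (j + 1) = n - j by omega]
  rfl

/-- The selected rows of the row chain are linearly independent rows of `A^{(ℓ)}`.  [folklore] -/
private theorem rowChain_linearIndependent {ℓ : ℕ} (h₁ : 1 ≤ ℓ) (h : ℓ ≤ n + 1) :
    LinearIndependent K (fun t => unfolding₂ F ℓ (n + 1 - ℓ) ((rowChain F n ℓ).sel t)) := by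
  obtain ⟨ℓ, rfl⟩ : ∃ ℓ', ℓ = ℓ' + 1 := ⟨ℓ - 1, by omega⟩
  rw [rowChain_succ F n (by omega), show n + 1 - (ℓ + 1) = n - ℓ by omega]
  exact (rowChain F n ℓ).step_linearIndependent (by omega)

/-- The selected columns of the column chain are linearly independent columns.  [folklore] -/
private theorem colChain_linearIndependent {j : ℕ} (h₁ : 1 ≤ j) (h : j ≤ n + 1) :
    LinearIndependent K (fun t => (unfolding₂ F (n + 1 - j) j)ᵀ ((colChain F n j).sel t)) := by
  obtain ⟨j, rfl⟩ : ∃ j', j = j' + 1 := ⟨j - 1, by omega⟩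
  rw [colChain_succ F n (by omega), show n + 1 - (j + 1) = n - j by omega]
  exact (colChain F n j).step_linearIndependent (by omega)

/-- Row nesting along the chain: every selected row at bond `ℓ + 1 ≤ n + 1` extends a selected row
at bond `ℓ` by one leg index.  [folklore] -/
private theorem rowChain_nested {ℓ : ℕ} (h : ℓ ≤ n) (t : Fin (rowChain F n (ℓ + 1)).k) :
    ∃ (s : Fin (rowChain F n ℓ).k) (c : σ),
      ((rowChain F n (ℓ + 1)).sel t).1 = ((rowChain F n ℓ).sel s).1 ++ [c] := by
  have key : ∀ R : RowSel F n (ℓ + 1), R = (rowChain F n ℓ).step h →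
      ∀ t : Fin R.k, ∃ (s : Fin (rowChain F n ℓ).k) (c : σ),
        (R.sel t).1 = ((rowChain F n ℓ).sel s).1 ++ [c] := by
    rintro _ rfl t
    exact (rowChain F n ℓ).step_nested h t
  exact key _ (rowChain_succ F n h) t

/-- Column nesting along the chain.  [folklore] -/
private theorem colChain_nested {j : ℕ} (h : j ≤ n) (t : Fin (colChain F n (j + 1)).k) :
    ∃ (s : Fin (colChain F n j).k) (a : σ),
      ((colChain F n (j + 1)).sel t).1 = a :: ((colChain F n j).sel s).1 := by
  have key : ∀ C : ColSel F n (j + 1), C = (colChain F n j).step h →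
      ∀ t : Fin C.k, ∃ (s : Fin (colChain F n j).k) (a : σ),
        (C.sel t).1 = a :: ((colChain F n j).sel s).1 := by
    rintro _ rfl t
    exact (colChain F n j).step_nested h t
  exact key _ (colChain_succ F n h) t

/-- Transport of the column chain along an equality of column lengths.  [folklore] -/
private theorem colChain_sel_congr {j j' : ℕ} (e : j = j') (t : Fin (colChain F n j).k) :
    ((colChain F n j).sel t).1 = ((colChain F n j').sel (t.cast (by rw [e]))).1 := by
  subst e
  rfl

/-- At an inner bond `1 ≤ ℓ ≤ n` the row chain and the column chain select equally many pivots
(`rank A^{(ℓ)} = rank (A^{(ℓ)})ᵀ`).  [folklore] -/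
private theorem rowChain_k_eq_colChain_k {ℓ : ℕ} (h₁ : 1 ≤ ℓ) (h : ℓ ≤ n) :
    (rowChain F n ℓ).k = (colChain F n (n + 1 - ℓ)).k := by
  rw [rowChain_k F n h₁ (by omega), colChain_k F n (by omega) (by omega),
    show n + 1 - (n + 1 - ℓ) = ℓ by omega, Matrix.rank_transpose]

end Chains

/-! ### The CI-canonical pivots of a tensor -/

section Canonical

variable {σ : Type*} [Fintype σ] {K : Type*} [Field K] (F : List σ → K) (n : ℕ) (d : σ)

/-- The bond dimensions of the CI-canonical pivots: `χ_ℓ = rank A^{(ℓ)}` at the inner bonds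
`1 ≤ ℓ ≤ n`, `χ_0 = χ_{n+1} = 1`, junk `0` beyond.  [cite: NunezFernandezEtAl2025, §4.5.1] -/
noncomputable def ciRank (ℓ : ℕ) : ℕ :=
  if 1 ≤ ℓ ∧ ℓ ≤ n then (rowChain F n ℓ).k else if ℓ ≤ n + 1 then 1 else 0

/-- [folklore] -/
private theorem ciRank_of_inner {ℓ : ℕ} (h : 1 ≤ ℓ ∧ ℓ ≤ n) :
    ciRank F n ℓ = (rowChain F n ℓ).k := by
  rw [ciRank, if_pos h]

/-- [folklore] -/
private theorem ciRank_eq_colChain_k {ℓ : ℕ} (h : 1 ≤ ℓ ∧ ℓ ≤ n) :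
    ciRank F n ℓ = (colChain F n (n + 1 - ℓ)).k := by
  rw [ciRank_of_inner F n h, rowChain_k_eq_colChain_k F n h.1 h.2]

/-- THE CI-CANONICAL PIVOTS OF THE TENSOR `F` (legs `0, …, n`, leg values in the finite type `σ`):
at every inner bond `1 ≤ ℓ ≤ n`, `χ_ℓ = rank A^{(ℓ)}` row pivots `I_ℓ` taken from the row chain
`I_0 < I_1 < ⋯` (left-nested, linearly independent rows of the unfolding `A^{(ℓ)}`) and `χ_ℓ`
column pivots `J_{ℓ+1}` taken from the column chain `⋯ > J_{n+1} > J_{n+2}` (right-nested,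
linearly independent columns of `A^{(ℓ)}`); trivial outer bonds.  (`d` is only used to fill the
never-read junk fields `col 0`, `row (n+1)`.)  This is the pivot structure of the TCI obtained by
CI-canonicalising an exact representation of `F`: all pivot matrices nonsingular, full nesting,
minimal bond dimensions.
[cite: NunezFernandezEtAl2025, §4.5.1][cite: DolgovSavostyanov2020, §3.2 Thms. 1–2] -/
noncomputable def ciPivots : TCIPivots σ where
  n := n
  χ := ciRank F n
  row ℓ x := if h : 1 ≤ ℓ ∧ ℓ ≤ n then
      ((rowChain F n ℓ).sel (x.cast (ciRank_of_inner F n h))).1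
    else List.replicate ℓ d
  col ℓ y := if h : 1 ≤ ℓ ∧ ℓ ≤ n then
      ((colChain F n (n + 1 - ℓ)).sel (y.cast (ciRank_eq_colChain_k F n h))).1
    else List.replicate (n + 1 - ℓ) d
  χ_zero := by simp [ciRank]
  χ_last := by simp [ciRank]
  length_row ℓ x := by
    split_ifs with h
    · exact ((rowChain F n ℓ).sel _).2
    · exact List.length_replicate
  length_col ℓ y := by
    split_ifs with h
    · exact ((colChain F n (n + 1 - ℓ)).sel _).2
    · exact List.length_replicate

/-- [cite: NunezFernandezEtAl2025, §4.5.1] -/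
@[simp] theorem ciPivots_n : (ciPivots F n d).n = n := rfl

/-- [folklore] -/
private theorem ciPivots_χ (ℓ : ℕ) : (ciPivots F n d).χ ℓ = ciRank F n ℓ := rfl

/-- [folklore] -/
private theorem ciPivots_row {ℓ : ℕ} (h : 1 ≤ ℓ ∧ ℓ ≤ n) (x : Fin ((ciPivots F n d).χ ℓ)) :
    (ciPivots F n d).row ℓ x = ((rowChain F n ℓ).sel (x.cast (ciRank_of_inner F n h))).1 := by
  show (if h : 1 ≤ ℓ ∧ ℓ ≤ n then _ else _) = _
  rw [dif_pos h]

/-- [folklore] -/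
private theorem ciPivots_col {ℓ : ℕ} (h : 1 ≤ ℓ ∧ ℓ ≤ n) (y : Fin ((ciPivots F n d).χ ℓ)) :
    (ciPivots F n d).col ℓ y =
      ((colChain F n (n + 1 - ℓ)).sel (y.cast (ciRank_eq_colChain_k F n h))).1 := by
  show (if h : 1 ≤ ℓ ∧ ℓ ≤ n then _ else _) = _
  rw [dif_pos h]

/-- [folklore] -/
private theorem ciPivots_row_of_not {ℓ : ℕ} (h : ¬ (1 ≤ ℓ ∧ ℓ ≤ n))
    (x : Fin ((ciPivots F n d).χ ℓ)) : (ciPivots F n d).row ℓ x = List.replicate ℓ d := by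
  show (if h : 1 ≤ ℓ ∧ ℓ ≤ n then _ else _) = _
  rw [dif_neg h]

/-- [folklore] -/
private theorem ciPivots_col_of_not {ℓ : ℕ} (h : ¬ (1 ≤ ℓ ∧ ℓ ≤ n))
    (y : Fin ((ciPivots F n d).χ ℓ)) :
    (ciPivots F n d).col ℓ y = List.replicate (n + 1 - ℓ) d := by
  show (if h : 1 ≤ ℓ ∧ ℓ ≤ n then _ else _) = _
  rw [dif_neg h]

/-- RANK-REVEALING BOND DIMENSIONS: at every inner bond the CI-canonical pivots have exactly
`χ_ℓ = rank A^{(ℓ)}` pivots, the rank of the `ℓ`-th unfolding matrix of `F`.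
[cite: NunezFernandezEtAl2025, §4.5.1][cite: DolgovSavostyanov2020, §3.2 Thm. 2] -/
theorem χ_ciPivots_eq_rank {ℓ : ℕ} (h₁ : 1 ≤ ℓ) (h : ℓ ≤ n) :
    (ciPivots F n d).χ ℓ = ((ciPivots F n d).unfolding F ℓ).rank := by
  rw [ciPivots_χ, ciRank_of_inner F n ⟨h₁, h⟩, rowChain_k F n h₁ (by omega)]
  rfl

/-- FULL NESTING of the CI-canonical pivots: `I_0 < I_1 < ⋯ < I_n` and `J_2 > ⋯ > J_{n+2}`.
[cite: NunezFernandezEtAl2025, §4.5.1 and §4.2][cite: NunezFernandezEtAl2022, eq. (17)] -/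
theorem fullyNested_ciPivots : (ciPivots F n d).FullyNested := by
  refine ⟨fun ℓ hℓ x' => ?_, fun ℓ h₁ h x => ?_⟩
  · -- row nesting at bond `ℓ < n`
    have hℓn : ℓ < n := hℓ
    have h' : 1 ≤ ℓ + 1 ∧ ℓ + 1 ≤ n := ⟨by omega, by omega⟩
    obtain ⟨s, c, hsc⟩ := rowChain_nested F n (by omega : ℓ ≤ n)
      (x'.cast (ciRank_of_inner F n h'))
    rcases Nat.eq_zero_or_pos ℓ with rfl | hpos
    · refine ⟨(ciPivots F n d).rowZero, c, ?_⟩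
      rw [ciPivots_row F n d h', hsc, ciPivots_row_of_not F n d (ℓ := 0) (by omega)]
      rfl
    · have h'' : 1 ≤ ℓ ∧ ℓ ≤ n := ⟨hpos, by omega⟩
      refine ⟨s.cast (ciRank_of_inner F n h'').symm, c, ?_⟩
      rw [ciPivots_row F n d h', hsc, ciPivots_row F n d h'']
      (try rfl)
  · -- column nesting at bond `1 ≤ ℓ ≤ n`
    have hℓn : ℓ ≤ n := h
    have h' : 1 ≤ ℓ ∧ ℓ ≤ n := ⟨h₁, hℓn⟩
    have e : n + 1 - ℓ = (n - ℓ) + 1 := by omega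
    obtain ⟨s, a, hsa⟩ := colChain_nested F n (by omega : n - ℓ ≤ n)
      ((x.cast (ciRank_eq_colChain_k F n h')).cast (by rw [e]))
    rcases Nat.lt_or_ge ℓ n with hlt | hge
    · have h'' : 1 ≤ ℓ + 1 ∧ ℓ + 1 ≤ n := ⟨by omega, by omega⟩
      have e' : n - ℓ = n + 1 - (ℓ + 1) := by omega
      refine ⟨((s.cast (by rw [e'])).cast (ciRank_eq_colChain_k F n h'').symm), a, ?_⟩
      rw [ciPivots_col F n d h', colChain_sel_congr F n e, hsa, ciPivots_col F n d h'',
        colChain_sel_congr F n e' s]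
      (try rfl)
    · have hℓ : ℓ = n := le_antisymm hℓn hge
      refine ⟨(ciPivots F n d).colLast.cast (by rw [ciPivots_n, hℓ]), a, ?_⟩
      rw [ciPivots_col F n d h', colChain_sel_congr F n e, hsa,
        ciPivots_col_of_not F n d (ℓ := ℓ + 1) (by omega)]
      have hs : ((colChain F n (n - ℓ)).sel s).1 = [] :=
        List.eq_nil_of_length_eq_zero (by rw [((colChain F n (n - ℓ)).sel s).2]; omega)
      rw [hs, hℓ, Nat.sub_self, List.replicate_zero]

/-- NONSINGULAR PIVOT MATRICES: every inner pivot matrix `P_ℓ = A^{(ℓ)}(I_ℓ, J_{ℓ+1})`,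
`1 ≤ ℓ ≤ n`, of the CI-canonical pivots is invertible (it is the cross of a row basis and a
column basis of `A^{(ℓ)}`).  [cite: NunezFernandezEtAl2025, §4.5.1][cite: DolgovSavostyanov2020, §3.2] -/
theorem isUnit_det_pivMat_ciPivots {ℓ : ℕ} (h₁ : 1 ≤ ℓ) (h : ℓ ≤ n) :
    IsUnit ((ciPivots F n d).pivMat F ℓ).det := by
  classical
  have h' : 1 ≤ ℓ ∧ ℓ ≤ n := ⟨h₁, h⟩
  let r : Fin ((ciPivots F n d).χ ℓ) → List.Vector σ ℓ := fun x =>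
    (rowChain F n ℓ).sel (x.cast (ciRank_of_inner F n h'))
  let c : Fin ((ciPivots F n d).χ ℓ) → List.Vector σ (n + 1 - ℓ) := fun y =>
    (colChain F n (n + 1 - ℓ)).sel (y.cast (ciRank_eq_colChain_k F n h'))
  have hP : (ciPivots F n d).pivMat F ℓ = (unfolding₂ F ℓ (n + 1 - ℓ)).submatrix r c := by
    ext x y
    simp only [TCIPivots.pivMat_apply, Matrix.submatrix_apply, unfolding₂_apply]
    rw [ciPivots_row F n d h' x, ciPivots_col F n d h' y]
  rw [hP]
  refine isUnit_det_submatrix_of_linearIndependent _ r c ?_ ?_ ?_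
  · exact (rowChain_linearIndependent F n h₁ (by omega)).comp _ (Fin.cast_injective _)
  · have hli := colChain_linearIndependent F n (j := n + 1 - ℓ) (by omega) (by omega)
    rw [show n + 1 - (n + 1 - ℓ) = ℓ by omega] at hli
    exact hli.comp _ (Fin.cast_injective _)
  · rw [ciPivots_χ, ciRank_of_inner F n h', rowChain_k F n h₁ (by omega)]

/-- THE CI-CANONICAL FORM IS EXACT: the fully nested TCI form
`F̃ = T₀ P₁⁻¹ T₁ ⋯ P_n⁻¹ T_n` built on the CI-canonical pivots reproduces the tensor at EVERY
configuration, `F̃(s) = F(s)` — by the exact-recovery theorem (`TCIPivots.tciEval_of_rank_eq`),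
since `χ_ℓ = rank A^{(ℓ)}` and every `P_ℓ` is nonsingular.  Every tensor with finitely many leg
values thus HAS an exact, fully nested TCI representation with bond dimensions its unfolding
ranks.  [cite: NunezFernandezEtAl2025, §4.5.1][cite: DolgovSavostyanov2020, §3.2 Thms. 1–2] -/
theorem tciEval_ciPivots (s : ℕ → σ) : (ciPivots F n d).tciEval F s = F (pfx s (n + 1)) :=
  (ciPivots F n d).tciEval_of_rank_eq F
    (fun _ h₁ h => (χ_ciPivots_eq_rank F n d h₁ h).symm)
    (fun _ h₁ h => isUnit_det_pivMat_ciPivots F n d h₁ h) s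

/-- Exactness of the CI-canonical form in configuration form: `F̃(l) = F(l)` for every list `l`
of `n + 1` leg indices.  [cite: NunezFernandezEtAl2025, §4.5.1][cite: DolgovSavostyanov2020, §3.2 Thm. 2] -/
theorem tciEval_ciPivots_toSeq (l : List σ) (hl : l.length = n + 1) (d' : σ) :
    (ciPivots F n d).tciEval F (toSeq l d') = F l :=
  (ciPivots F n d).tciEval_toSeq_of_rank_eq F
    (fun _ h₁ h => (χ_ciPivots_eq_rank F n d h₁ h).symm)
    (fun _ h₁ h => isUnit_det_pivMat_ciPivots F n d h₁ h) l hl d'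

/-- EXISTENCE OF THE CI-CANONICAL FORM (prose form of the file's theorem): every tensor with
`n + 1` legs and finitely many leg values admits pivot lists that are FULLY NESTED, have
`χ_ℓ = rank A^{(ℓ)}` pivots and a NONSINGULAR pivot matrix at every inner bond, and whose TCI
form reproduces the tensor exactly.
[cite: NunezFernandezEtAl2025, §4.5.1][cite: DolgovSavostyanov2020, §3.2 Thms. 1–2][cite: NunezFernandezEtAl2022, §III.B.1] -/
theorem exists_fullyNested_exact_tci [Nonempty σ] (F : List σ → K) (n : ℕ) :
    ∃ p : TCIPivots σ, p.n = n ∧ p.FullyNested ∧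
      (∀ ℓ, 1 ≤ ℓ → ℓ ≤ n → p.χ ℓ = (p.unfolding F ℓ).rank ∧ IsUnit (p.pivMat F ℓ).det) ∧
      ∀ s : ℕ → σ, p.tciEval F s = F (pfx s (n + 1)) := by
  obtain ⟨d⟩ := ‹Nonempty σ›
  exact ⟨ciPivots F n d, rfl, fullyNested_ciPivots F n d,
    fun ℓ h₁ h => ⟨χ_ciPivots_eq_rank F n d h₁ h, isUnit_det_pivMat_ciPivots F n d h₁ h⟩,
    tciEval_ciPivots F n d⟩

end Canonical

/-! ### The two matrix regroupings of a slice -/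

section Slices

variable {σ : Type*} {K : Type*} (p : TCIPivots σ) (F : List σ → K)

/-- The site tensor `T_ℓ` of leg `ℓ` regrouped as the `(χ_ℓ · |𝕊|) × χ_{ℓ+1}` matrix
`((x, a), y) ↦ F (row ℓ x ⊕ (a) ⊕ col (ℓ+1) y)` (rows `I_ℓ × 𝕊_ℓ`, columns `J_{ℓ+2}`).
[cite: NunezFernandezEtAl2025, §4.4.1 and §4.5.1] -/
def TCIPivots.siteMatRows (ℓ : ℕ) : Matrix (Fin (p.χ ℓ) × σ) (Fin (p.χ (ℓ + 1))) K :=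
  Matrix.of fun q y => p.siteMat F ℓ q.2 q.1 y

/-- The site tensor `T_ℓ` regrouped as the `χ_ℓ × (|𝕊| · χ_{ℓ+1})` matrix
`(x, (a, y)) ↦ F (row ℓ x ⊕ (a) ⊕ col (ℓ+1) y)` (rows `I_ℓ`, columns `𝕊_ℓ × J_{ℓ+2}`).
[cite: NunezFernandezEtAl2025, §4.4.1 and §4.5.1] -/
def TCIPivots.siteMatCols (ℓ : ℕ) : Matrix (Fin (p.χ ℓ)) (σ × Fin (p.χ (ℓ + 1))) K :=
  Matrix.of fun x q => p.siteMat F ℓ q.1 x q.2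

/-- Under row nesting `I_{ℓ+1} ⊆ I_ℓ × 𝕊_ℓ`, the pivot matrix `P_{ℓ+1}` is a row-submatrix of
`T_ℓ` regrouped as `(I_ℓ × 𝕊_ℓ) × J_{ℓ+2}`.  [cite: NunezFernandezEtAl2025, §4.4.1 and App. A.3] -/
theorem TCIPivots.submatrix_siteMatRows_eq_pivMat {ℓ : ℕ} (g : Fin (p.χ (ℓ + 1)) → Fin (p.χ ℓ) × σ)
    (hg : ∀ x', p.row (ℓ + 1) x' = p.row ℓ (g x').1 ++ [(g x').2]) :
    (p.siteMatRows F ℓ).submatrix g id = p.pivMat F (ℓ + 1) := by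
  ext x' y
  simp only [Matrix.submatrix_apply, id, TCIPivots.siteMatRows, Matrix.of_apply,
    TCIPivots.siteMat_apply, TCIPivots.pivMat_apply, hg x', List.append_assoc,
    List.singleton_append]

/-- Under column nesting `J_{ℓ+1} ⊆ 𝕊_ℓ × J_{ℓ+2}`, the pivot matrix `P_ℓ` is a column-submatrix
of `T_ℓ` regrouped as `I_ℓ × (𝕊_ℓ × J_{ℓ+2})`.  [cite: NunezFernandezEtAl2025, §4.4.1 and App. A.3] -/
theorem TCIPivots.submatrix_siteMatCols_eq_pivMat {ℓ : ℕ} (g : Fin (p.χ ℓ) → σ × Fin (p.χ (ℓ + 1)))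
    (hg : ∀ y, p.col ℓ y = (g y).1 :: p.col (ℓ + 1) (g y).2) :
    (p.siteMatCols F ℓ).submatrix id g = p.pivMat F ℓ := by
  ext x y
  simp only [Matrix.submatrix_apply, id, TCIPivots.siteMatCols, Matrix.of_apply,
    TCIPivots.siteMat_apply, TCIPivots.pivMat_apply, hg y]

end Slices

/-! ### Minimality of the bond dimensions and full rank of the slices -/

section Minimality

variable {σ : Type*} [Fintype σ] {K : Type*} [Field K] (p : TCIPivots σ) (F : List σ → K)

/-- LOWER BOUND: at a bond with a NONSINGULAR pivot matrix, any TCI pivot structure has at most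
`rank A^{(ℓ)}` pivots, `χ_ℓ ≤ rank A^{(ℓ)}` (the pivot matrix is a nonsingular `χ_ℓ × χ_ℓ`
submatrix of the unfolding) — so the CI-canonical bond dimensions `rank A^{(ℓ)}` are the largest
possible with nonsingular pivot matrices, and (`TCIPivots.tciEval_toSeq_eq_iff_rank_eq`) the only
ones for which the TCI form is exact.  [cite: DolgovSavostyanov2020, §3.2 Thm. 2][cite: NunezFernandezEtAl2025, §4.5.1] -/
theorem TCIPivots.χ_le_rank_unfolding {ℓ : ℕ} (hP : IsUnit (p.pivMat F ℓ).det) :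
    p.χ ℓ ≤ (p.unfolding F ℓ).rank := by
  have hP' : IsUnit ((p.unfolding F ℓ).submatrix
      (fun x => (⟨p.row ℓ x, p.length_row ℓ x⟩ : List.Vector σ ℓ))
      (fun y => (⟨p.col ℓ y, p.length_col ℓ y⟩ : List.Vector σ (p.n + 1 - ℓ)))).det := by
    rw [TCIPivots.submatrix_unfolding]; exact hP
  simpa using Literature.LinearAlgebra.Matrix.card_le_rank_of_isUnit_det_submatrix _ hP'

/-- UNIQUENESS OF THE BOND DIMENSIONS OF AN EXACT TCI: if pivot lists with nonsingular inner pivot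
matrices give a TCI form that reproduces `F` everywhere, then `χ_ℓ = rank A^{(ℓ)}` at every inner
bond — the bond dimensions of the CI-canonical pivots.
[cite: DolgovSavostyanov2020, §3.2 Thm. 2][cite: NunezFernandezEtAl2025, §4.5.1] -/
theorem TCIPivots.χ_eq_χ_ciPivots_of_exact (hP : ∀ ℓ, 1 ≤ ℓ → ℓ ≤ p.n → IsUnit (p.pivMat F ℓ).det)
    (d : σ) (hexact : ∀ l : List σ, l.length = p.n + 1 → p.tciEval F (toSeq l d) = F l)
    {ℓ : ℕ} (h₁ : 1 ≤ ℓ) (h : ℓ ≤ p.n) :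
    p.χ ℓ = (ciPivots F p.n d).χ ℓ := by
  rw [χ_ciPivots_eq_rank F p.n d h₁ h, ← (p.tciEval_toSeq_eq_iff_rank_eq F hP d).1 hexact ℓ h₁ h]
  rfl

omit [Fintype σ] in
/-- FULL RANK OF THE SLICES, first regrouping: if `I_ℓ < I_{ℓ+1}` and `P_{ℓ+1}` is nonsingular,
then `T_ℓ` viewed as an `(I_ℓ × 𝕊_ℓ) × J_{ℓ+2}` matrix has full column rank `χ_{ℓ+1}` (it
contains the nonsingular `P_{ℓ+1}` as a row-submatrix).  In CI-canonical form "each `T_ℓ` is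
full rank for both ways of viewing it as a matrix".  [cite: NunezFernandezEtAl2025, §4.5.1] -/
theorem TCIPivots.rank_siteMatRows_of_rowNested {ℓ : ℕ} (hN : p.RowNested ℓ)
    (hP : IsUnit (p.pivMat F (ℓ + 1)).det) : (p.siteMatRows F ℓ).rank = p.χ (ℓ + 1) := by
  classical
  choose x a hxa using hN
  have hsub := p.submatrix_siteMatRows_eq_pivMat F (fun x' => (x x', a x')) hxa
  refine le_antisymm ?_ ?_
  · simpa using Matrix.rank_le_card_width (p.siteMatRows F ℓ)
  · calc p.χ (ℓ + 1) = Fintype.card (Fin (p.χ (ℓ + 1))) := (Fintype.card_fin _).symm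
      _ = (p.pivMat F (ℓ + 1)).rank :=
        (Matrix.rank_of_isUnit _ ((Matrix.isUnit_iff_isUnit_det _).2 hP)).symm
      _ = ((p.siteMatRows F ℓ).submatrix (fun x' => (x x', a x')) id).rank := by rw [hsub]
      _ ≤ (p.siteMatRows F ℓ).rank := Matrix.rank_submatrix_le _ _ _

/-- FULL RANK OF THE SLICES, second regrouping: if `J_{ℓ+1} > J_{ℓ+2}` and `P_ℓ` is nonsingular,
then `T_ℓ` viewed as an `I_ℓ × (𝕊_ℓ × J_{ℓ+2})` matrix has full row rank `χ_ℓ`.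
[cite: NunezFernandezEtAl2025, §4.5.1] -/
theorem TCIPivots.rank_siteMatCols_of_colNested {ℓ : ℕ} (hN : p.ColNested ℓ)
    (hP : IsUnit (p.pivMat F ℓ).det) : (p.siteMatCols F ℓ).rank = p.χ ℓ := by
  classical
  choose y a hya using hN
  have hsub := p.submatrix_siteMatCols_eq_pivMat F (fun y₀ => (a y₀, y y₀)) hya
  refine le_antisymm ?_ ?_
  · simpa using Matrix.rank_le_card_height (p.siteMatCols F ℓ)
  · calc p.χ ℓ = Fintype.card (Fin (p.χ ℓ)) := (Fintype.card_fin _).symm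
      _ = (p.pivMat F ℓ).rank :=
        (Matrix.rank_of_isUnit _ ((Matrix.isUnit_iff_isUnit_det _).2 hP)).symm
      _ = ((p.siteMatCols F ℓ).submatrix id (fun y₀ => (a y₀, y y₀))).rank := by rw [hsub]
      _ ≤ (p.siteMatCols F ℓ).rank := Matrix.rank_submatrix_le _ _ _

/-- In CI-canonical form every slice `T_ℓ`, `ℓ < n`, has full column rank `χ_{ℓ+1}` as an
`(I_ℓ × 𝕊_ℓ) × J_{ℓ+2}` matrix.  [cite: NunezFernandezEtAl2025, §4.5.1] -/
theorem rank_siteMatRows_ciPivots (n : ℕ) (d : σ) {ℓ : ℕ} (hℓ : ℓ < n) :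
    ((ciPivots F n d).siteMatRows F ℓ).rank = (ciPivots F n d).χ (ℓ + 1) :=
  (ciPivots F n d).rank_siteMatRows_of_rowNested F ((fullyNested_ciPivots F n d).1 ℓ hℓ)
    (isUnit_det_pivMat_ciPivots F n d (by omega) (by simpa using hℓ))

/-- In CI-canonical form every slice `T_ℓ`, `1 ≤ ℓ ≤ n`, has full row rank `χ_ℓ` as an
`I_ℓ × (𝕊_ℓ × J_{ℓ+2})` matrix.  [cite: NunezFernandezEtAl2025, §4.5.1] -/
theorem rank_siteMatCols_ciPivots (n : ℕ) (d : σ) {ℓ : ℕ} (h₁ : 1 ≤ ℓ) (h : ℓ ≤ n) :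
    ((ciPivots F n d).siteMatCols F ℓ).rank = (ciPivots F n d).χ ℓ :=
  (ciPivots F n d).rank_siteMatCols_of_colNested F ((fullyNested_ciPivots F n d).2 ℓ h₁ h)
    (isUnit_det_pivMat_ciPivots F n d h₁ h)

end Minimality

/-! ### Tensor trains: conversion to an exact fully nested TCI with `χ_ℓ ≤ r_ℓ` -/

section TensorTrain

variable {σ : Type*} [Fintype σ] {K : Type*} [Field K] (F : List σ → K)

/-- The unfolding rank of a tensor train is at most its bond dimension: if `F` agrees on
configurations with the tensor train `T` (`n + 1` cores), then `rank A^{(ℓ)} ≤ r_ℓ` for every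
`ℓ ≤ n + 1` — the unfolding factors through `K^{r_ℓ}` (`TensorTrain.eval_append_eq_sum_bond`).
[cite: NunezFernandezEtAl2022, §III.B.1][cite: DolgovSavostyanov2020, §3.2] -/
theorem rank_unfolding₂_le_of_tensorTrain {n : ℕ} (T : TensorTrain K σ (n + 1))
    (hF : ∀ s : Fin (n + 1) → σ, F (List.ofFn s) = T.eval s) {ℓ : ℕ} (hℓ : ℓ ≤ n + 1) :
    (unfolding₂ F ℓ (n + 1 - ℓ)).rank ≤ T.r ℓ := by
  classical
  have h : ℓ + (n + 1 - ℓ) = n + 1 := by omega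
  let U : Matrix (List.Vector σ ℓ) (Fin (T.r ℓ)) K := Matrix.of fun x t =>
    (T.lbdry ᵥ* T.leftProd ℓ fun i => x.1.get (i.cast x.2.symm)) t
  let V : Matrix (Fin (T.r ℓ)) (List.Vector σ (n + 1 - ℓ)) K := Matrix.of fun t y =>
    ((Matrix.of fun l j => T.segProd ℓ (n + 1 - ℓ) (fun i => y.1.get (i.cast y.2.symm)) l
        (j.cast (congrArg T.r h).symm)) *ᵥ T.rbdry) t
  have hUV : unfolding₂ F ℓ (n + 1 - ℓ) = U * V := by
    ext x y
    rw [unfolding₂_apply, Matrix.mul_apply]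
    set sx : Fin ℓ → σ := fun i => x.1.get (i.cast x.2.symm) with hsx
    set sy : Fin (n + 1 - ℓ) → σ := fun i => y.1.get (i.cast y.2.symm) with hsy
    have hxy : x.1 ++ y.1 = List.ofFn fun i => Fin.append sx sy (i.cast h.symm) := by
      rw [← List.ofFn_congr h (Fin.append sx sy), List.ofFn_fin_append, hsx, hsy,
        ← List.ofFn_congr x.2 x.1.get, ← List.ofFn_congr y.2 y.1.get, List.ofFn_get,
        List.ofFn_get]
    rw [hxy, hF, T.eval_append_eq_sum_bond ℓ (n + 1 - ℓ) h sx sy]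
    rfl
  rw [hUV]
  calc (U * V).rank ≤ U.rank := Matrix.rank_mul_le_left _ _
    _ ≤ Fintype.card (Fin (T.r ℓ)) := Matrix.rank_le_card_width _
    _ = T.r ℓ := Fintype.card_fin _

/-- MPS → TCI CONVERSION, bond dimensions: the CI-canonical pivots of (the tensor represented by)
a tensor train with bond dimensions `r_ℓ` have `χ_ℓ = rank A^{(ℓ)} ≤ r_ℓ` at every inner bond —
the exact fully nested TCI representation is never larger than the given tensor train.
[cite: NunezFernandezEtAl2025, §4.5][cite: NunezFernandezEtAl2022, §III.B.1] -/
theorem χ_ciPivots_le_of_tensorTrain {n : ℕ} (T : TensorTrain K σ (n + 1))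
    (hF : ∀ s : Fin (n + 1) → σ, F (List.ofFn s) = T.eval s) (d : σ) {ℓ : ℕ} (h₁ : 1 ≤ ℓ)
    (h : ℓ ≤ n) : (ciPivots F n d).χ ℓ ≤ T.r ℓ := by
  rw [χ_ciPivots_eq_rank F n d h₁ h]
  exact rank_unfolding₂_le_of_tensorTrain F T hF (by omega)

/-- MPS → TCI CONVERSION, exactness: the fully nested TCI form on the CI-canonical pivots of a
tensor train reproduces the tensor train at every configuration.
[cite: NunezFernandezEtAl2025, §4.5][cite: NunezFernandezEtAl2022, §III.B.1] -/
theorem tciEval_ciPivots_ofFn_of_tensorTrain {n : ℕ} (T : TensorTrain K σ (n + 1))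
    (hF : ∀ s : Fin (n + 1) → σ, F (List.ofFn s) = T.eval s) (d : σ) (s : Fin (n + 1) → σ) :
    (ciPivots F n d).tciEval F (toSeq (List.ofFn s) d) = T.eval s := by
  rw [tciEval_ciPivots_toSeq F n d (List.ofFn s) (by simp) d, hF]

end TensorTrain



end Literature.LinearAlgebra.TensorNetworks
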